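import Mathlib
import Summits.CriticalPhenomena.PercolationContinuityZ3.Theorems.PercNearOneGluingNoHeavyLowerTailOrientedAntipodalHallOrderedAssignment

/-!
# SDR form of the oriented antipodal Hall count with an ordered middle group

Helper file for crux `stmt-CriticalPhenomena-4575` (`NoHeavyLowerTail`, route `PercNearOneGluingNoHeavy`),
new-inequality factory seat `prim-ineq-gen-3` (gen 11).  Everything here is PROVED.

Hall's marriage theorem applied to `OrientedAntipodalHall.card_le_card_goods_above_of_ordered_assignment` (which is
inherited by sub-families): under a three-group assignment with an ordered middle group the bads admit DISTINCT good
representatives above them (`exists_injective_good_above_of_ordered_assignment`).  (prim-ineq-gen-3 gen 11, 2026-08-20.)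
-/

namespace Summit.CriticalPhenomena.PercolationContinuityZ3.Theorems

namespace OrientedAntipodalHall

open Finset AntipodalStrongHarris AntipodalStrongHarris.Lab ThreeFamilyRank
open scoped FinsetFamily

variable {α : Type*} [DecidableEq α] {k : ℕ}

/-- **SDR form.**  Under a three-group assignment with an ordered middle group the bads admit DISTINCT good representatives
above them. -/
theorem exists_injective_good_above_of_ordered_assignment (S : Finset α) {f : Finset α → Lab k}
    (hf : ∀ ⦃X Y : Finset α⦄, X ⊆ Y → f X ≤ f Y) (D₁ D₂ D₃ : Finset (Finset α))
    (cpl : Finset α → Bool) (a b : Finset α → Fin k)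
    (hlab : ∀ X ∈ D₁ ∪ D₂ ∪ D₃, X ⊆ S ∧ (cpl X = false → f X = petal (a X) ∧ f (S \ X) = petal (b X)) ∧
      (cpl X = true → f (S \ X) = petal (a X) ∧ f X = petal (b X)))
    (hW₁ : ∀ X ∈ D₁, ∀ X' ∈ D₁, cpl X = cpl X' ∧ a X ≠ b X' ∧ b X ≠ a X')
    (hW₂ : ∀ X ∈ D₂, ∀ X' ∈ D₂, a X ≠ b X' ∧ b X ≠ a X' ∧
      (cpl X = true → cpl X' = false → ¬ (a X = a X' ∧ b X = b X')))
    (hW₃ : ∀ X ∈ D₃, ∀ X' ∈ D₃, cpl X = cpl X' ∧ a X ≠ b X' ∧ b X ≠ a X')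
    (hC₁₂ : ∀ X ∈ D₁, ∀ Y ∈ D₂, a X ≠ a Y ∧ b X ≠ b Y ∧ (cpl X = true ∨ cpl Y = true) ∧ ¬ (a X = b Y ∧ a Y = b X))
    (hC₂₃ : ∀ Y ∈ D₂, ∀ Z ∈ D₃, a Y ≠ a Z ∧ b Y ≠ b Z ∧ (cpl Y = true ∨ cpl Z = true) ∧ ¬ (a Y = b Z ∧ a Z = b Y))
    (hC₃₁ : ∀ Z ∈ D₃, ∀ X ∈ D₁, a Z ≠ a X ∧ b Z ≠ b X ∧ (cpl Z = true ∨ cpl X = true) ∧ ¬ (a Z = b X ∧ a X = b Z))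
    (hDD₁ : ∀ X ∈ D₁, ∀ Y ∈ D₂, ∀ Z ∈ D₃,
      ¬ (a X = b Y ∧ b Y = b Z) ∧ ¬ (b X = a Y ∧ a Y = a Z) ∧ (cpl X = true ∨ cpl Y = false ∨ cpl Z = false))
    (hDD₃ : ∀ X ∈ D₁, ∀ Y ∈ D₂, ∀ Z ∈ D₃,
      ¬ (a Z = b X ∧ b X = b Y) ∧ ¬ (b Z = a X ∧ a X = a Y) ∧ (cpl Z = true ∨ cpl X = false ∨ cpl Y = false)) :
    ∃ φ : ↥(D₁ ∪ D₂ ∪ D₃) → Finset α, Function.Injective φ ∧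
      ∀ X : ↥(D₁ ∪ D₂ ∪ D₃), (X : Finset α) ⊆ φ X ∧ φ X ⊆ S ∧ f (φ X) = top ∧ f (S \ φ X) = bot := by
  classical
  let t : ↥(D₁ ∪ D₂ ∪ D₃) → Finset (Finset α) := fun X =>
    {U ∈ S.powerset | f U = top ∧ f (S \ U) = bot ∧ (X : Finset α) ⊆ U}
  have hHall : ∀ s : Finset ↥(D₁ ∪ D₂ ∪ D₃), #s ≤ #(s.biUnion t) := by
    intro s
    set D' : Finset (Finset α) := s.map (Function.Embedding.subtype _) with hD'
    have hD'sub : ∀ X ∈ D', X ∈ D₁ ∪ D₂ ∪ D₃ := by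
      intro X hX
      obtain ⟨x, -, rfl⟩ := mem_map.mp hX
      exact x.2
    set E₁ : Finset (Finset α) := D'.filter (· ∈ D₁) with hE₁
    set E₂ : Finset (Finset α) := (D'.filter (· ∉ D₁)).filter (· ∈ D₂) with hE₂
    set E₃ : Finset (Finset α) := (D'.filter (· ∉ D₁)).filter (· ∉ D₂) with hE₃
    have hE₁sub : ∀ X ∈ E₁, X ∈ D₁ := fun X hX => (mem_filter.mp hX).2
    have hE₂sub : ∀ X ∈ E₂, X ∈ D₂ := fun X hX => (mem_filter.mp hX).2
    have hE₃sub : ∀ X ∈ E₃, X ∈ D₃ := by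
      intro X hX
      obtain ⟨hX', hX2⟩ := mem_filter.mp hX
      obtain ⟨hXD', hX1⟩ := mem_filter.mp hX'
      rcases mem_union.mp (hD'sub X hXD') with h | h
      · rcases mem_union.mp h with h | h
        · exact absurd h hX1
        · exact absurd h hX2
      · exact h
    have hEsub : ∀ X ∈ E₁ ∪ E₂ ∪ E₃, X ∈ D₁ ∪ D₂ ∪ D₃ := by
      intro X hX
      rcases mem_union.mp hX with h | h
      · rcases mem_union.mp h with h | h
        · exact mem_union_left _ (mem_union_left _ (hE₁sub X h))
        · exact mem_union_left _ (mem_union_right _ (hE₂sub X h))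
      · exact mem_union_right _ (hE₃sub X h)
    have hcard : #s = #E₁ + #E₂ + #E₃ := by
      rw [hE₁, hE₂, hE₃, add_assoc, card_filter_add_card_filter_not, card_filter_add_card_filter_not]
      exact (card_map _).symm
    have hle := card_le_card_goods_above_of_ordered_assignment S hf E₁ E₂ E₃ cpl a b
      (fun X hX => hlab X (hEsub X hX))
      (fun X hX X' hX' => hW₁ X (hE₁sub X hX) X' (hE₁sub X' hX'))
      (fun X hX X' hX' => hW₂ X (hE₂sub X hX) X' (hE₂sub X' hX'))
      (fun X hX X' hX' => hW₃ X (hE₃sub X hX) X' (hE₃sub X' hX'))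
      (fun X hX Y hY => hC₁₂ X (hE₁sub X hX) Y (hE₂sub Y hY))
      (fun Y hY Z hZ => hC₂₃ Y (hE₂sub Y hY) Z (hE₃sub Z hZ))
      (fun Z hZ X hX => hC₃₁ Z (hE₃sub Z hZ) X (hE₁sub X hX))
      (fun X hX Y hY Z hZ => hDD₁ X (hE₁sub X hX) Y (hE₂sub Y hY) Z (hE₃sub Z hZ))
      (fun X hX Y hY Z hZ => hDD₃ X (hE₁sub X hX) Y (hE₂sub Y hY) Z (hE₃sub Z hZ))
    have hED' : ∀ X ∈ E₁ ∪ E₂ ∪ E₃, X ∈ D' := by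
      intro X hX
      rcases mem_union.mp hX with h | h
      · rcases mem_union.mp h with h | h
        · exact (mem_filter.mp h).1
        · exact (mem_filter.mp (mem_filter.mp h).1).1
      · exact (mem_filter.mp (mem_filter.mp h).1).1
    have hgoods : {U ∈ S.powerset | f U = top ∧ f (S \ U) = bot ∧ ∃ X ∈ E₁ ∪ E₂ ∪ E₃, X ⊆ U} ⊆
        s.biUnion t := by
      intro U hU
      rw [mem_filter, mem_powerset] at hU
      obtain ⟨hUS, hUtop, hUbot, X, hX, hXU⟩ := hU
      obtain ⟨x, hx, rfl⟩ := mem_map.mp (hED' X hX)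
      rw [mem_biUnion]
      refine ⟨x, hx, ?_⟩
      simp only [t, mem_filter, mem_powerset]
      exact ⟨hUS, hUtop, hUbot, hXU⟩
    calc #s = #E₁ + #E₂ + #E₃ := hcard
      _ ≤ #{U ∈ S.powerset | f U = top ∧ f (S \ U) = bot ∧ ∃ X ∈ E₁ ∪ E₂ ∪ E₃, X ⊆ U} := hle
      _ ≤ #(s.biUnion t) := card_le_card hgoods
  obtain ⟨φ, hφinj, hφ⟩ := (all_card_le_biUnion_card_iff_exists_injective t).mp hHall
  refine ⟨φ, hφinj, fun X => ?_⟩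
  have hX := hφ X
  simp only [t, mem_filter, mem_powerset] at hX
  exact ⟨hX.2.2.2, hX.1, hX.2.1, hX.2.2.1⟩

end OrientedAntipodalHall

end Summit.CriticalPhenomena.PercolationContinuityZ3.Theorems
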